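import Mathlib
import Summits.Ventures.PercRepro2.TypedResidualSplit
import Summits.Ventures.PercRepro2.TypedVanishing

/-!
# The residual class with distinct roots (blind cell PercRepro2, p2 g0, 2026-08-25; sub-claim
S1, `proofs/subclaims/S1-REDUCTION.md`)

p1's typed root-coincidence theorems (TypedVanishing.lean: a typed base vanishes when `a₂ = a₁`,
or when `a₃`, `o` or `b` coincides with a root) let the residual class of sub-claim S1 be
restricted further, at no cost, to the instances whose ROOTS ARE DISTINCT FROM EVERY OTHER MARK
(`RootsDistinct`): the remaining coincidences are among `o`, `a₃`, `b` only.

* `typedCount_eq_zero_of_not_rootsDistinct` — a coincidence with a root kills the typed base;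
* **`typedCount_nonneg_of_residual_rootsDistinct`**, **`HCov_all_of_residual_rootsDistinct`** — the
  spine with the hypothesis restricted to `Residual ∧ RootsDistinct`;
* **`HCov_all_of_sep_con_rootsDistinct`** — the same for the split `ResidualSep ⊔ ResidualCon`.

Own code; standard axioms.
-/

namespace Summit.Ventures.PercRepro2

open UnionCluster

namespace CovForm

namespace TypedRed

section Marks

variable {V : Type*} {E : Type*} [DecidableEq V] [Fintype E] [DecidableEq E]

/-- The two roots are distinct from each other and from `o`, `a₃`, `b`. -/
def RootsDistinct (o a₁ a₂ a₃ b : V) : Prop :=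
  a₁ ≠ a₂ ∧ a₃ ≠ a₁ ∧ a₃ ≠ a₂ ∧ o ≠ a₁ ∧ o ≠ a₂ ∧ b ≠ a₁ ∧ b ≠ a₂

variable {R : Type*} [Field R] [LinearOrder R] [IsStrictOrderedRing R]

omit [DecidableEq V] in
/-- **A coincidence with a root kills every typed base** (TypedVanishing.lean, p1). -/
theorem typedCount_eq_zero_of_not_rootsDistinct (ends : E → Sym2 V) {o a₁ a₂ a₃ b : V}
    (h : ¬ RootsDistinct o a₁ a₂ a₃ b) (F : Finset E) (z : Config E) (τ : E → ℕ) :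
    typedCount F z τ (K3 ends o a₁ a₂ a₃ b : Config E → Config E → Config E → R) = 0 := by
  unfold RootsDistinct at h
  by_cases h12 : a₁ = a₂
  · subst h12; exact TypedVanish.typedCount_eq_zero_of_a2_eq_a1 ends o a₁ a₃ b F z τ
  by_cases h31 : a₃ = a₁
  · subst h31; exact TypedVanish.typedCount_eq_zero_of_a3_eq_a1 ends o a₃ a₂ b F z τ
  by_cases h32 : a₃ = a₂
  · subst h32; exact TypedVanish.typedCount_eq_zero_of_a3_eq_a2 ends o a₁ a₃ b F z τ
  by_cases ho1 : o = a₁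
  · subst ho1; exact TypedVanish.typedCount_eq_zero_of_o_eq_a1 ends o a₂ a₃ b F z τ
  by_cases ho2 : o = a₂
  · subst ho2; exact TypedVanish.typedCount_eq_zero_of_o_eq_a2 ends a₁ o a₃ b F z τ
  by_cases hb1 : b = a₁
  · subst hb1; exact TypedVanish.typedCount_eq_zero_of_b_eq_a1 ends o b a₂ a₃ F z τ
  by_cases hb2 : b = a₂
  · subst hb2; exact TypedVanish.typedCount_eq_zero_of_b_eq_a2 ends o a₁ b a₃ F z τ
  exact absurd ⟨h12, h31, h32, ho1, ho2, hb1, hb2⟩ h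

/-- **The spine with distinct roots**: (TRI) on the residual instances whose roots are distinct
from every other mark gives (TRI) on every instance. -/
theorem typedCount_nonneg_of_residual_rootsDistinct
    (hNR : ∀ (ends : E → Sym2 V) (o a₁ a₂ a₃ b : V) (F : Finset E) (τ : E → ℕ),
      (∀ e ∈ F, τ e = 1 ∨ τ e = 2) → Residual ends o a₁ a₂ a₃ b F → RootsDistinct o a₁ a₂ a₃ b →
        0 ≤ typedCount F (fun _ => false) τ
          (K3 ends o a₁ a₂ a₃ b : Config E → Config E → Config E → R))
    (ends : E → Sym2 V) (o a₁ a₂ a₃ b : V) (F : Finset E) (z : Config E) (τ : E → ℕ)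
    (hτ : ∀ e ∈ F, τ e = 1 ∨ τ e = 2) :
    0 ≤ typedCount F z τ (K3 ends o a₁ a₂ a₃ b : Config E → Config E → Config E → R) := by
  refine typedCount_nonneg_of_residual (fun ends o a₁ a₂ a₃ b F τ hτ hres => ?_) ends o a₁ a₂ a₃ b
    F z τ hτ
  by_cases hd : RootsDistinct o a₁ a₂ a₃ b
  · exact hNR ends o a₁ a₂ a₃ b F τ hτ hres hd
  · rw [typedCount_eq_zero_of_not_rootsDistinct ends hd]

end Marks

section Closure

variable (R : Type*) [Field R] [LinearOrder R] [IsStrictOrderedRing R]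

/-- **Row 2′TRI on the residual instances with distinct roots, over every finite graph.** -/
def ResidualD_all : Prop :=
  ∀ (V E : Type) [Fintype V] [DecidableEq V] [Fintype E] [DecidableEq E]
    (ends : E → Sym2 V) (o a₁ a₂ a₃ b : V) (F : Finset E) (τ : E → ℕ),
    (∀ e ∈ F, τ e = 1 ∨ τ e = 2) → Residual ends o a₁ a₂ a₃ b F → RootsDistinct o a₁ a₂ a₃ b →
      0 ≤ typedCount F (fun _ => false) τ
        (K3 ends o a₁ a₂ a₃ b : Config E → Config E → Config E → R)

/-- **Row 2′TRI on the separated residual instances with distinct roots.** -/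
def ResidualSepD_all : Prop :=
  ∀ (V E : Type) [Fintype V] [DecidableEq V] [Fintype E] [DecidableEq E]
    (ends : E → Sym2 V) (o a₁ a₂ a₃ b : V) (F : Finset E) (τ : E → ℕ),
    (∀ e ∈ F, τ e = 1 ∨ τ e = 2) → ResidualSep ends o a₁ a₂ a₃ b F →
      RootsDistinct o a₁ a₂ a₃ b →
      0 ≤ typedCount F (fun _ => false) τ
        (K3 ends o a₁ a₂ a₃ b : Config E → Config E → Config E → R)

/-- **Row 2′TRI on the connected residual instances with distinct roots** (sub-claim S4's domain
with the root coincidences removed). -/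
def ResidualConD_all : Prop :=
  ∀ (V E : Type) [Fintype V] [DecidableEq V] [Fintype E] [DecidableEq E]
    (ends : E → Sym2 V) (o a₁ a₂ a₃ b : V) (F : Finset E) (τ : E → ℕ),
    (∀ e ∈ F, τ e = 1 ∨ τ e = 2) → ResidualCon ends o a₁ a₂ a₃ b F →
      RootsDistinct o a₁ a₂ a₃ b →
      0 ≤ typedCount F (fun _ => false) τ
        (K3 ends o a₁ a₂ a₃ b : Config E → Config E → Config E → R)

/-- (TRI) on the distinct-root residual instances is (TRI) on `NR`. -/
theorem residual_all_of_residualD_all (h : ResidualD_all R) : Residual_all R := by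
  intro V E _ _ _ _ ends o a₁ a₂ a₃ b F τ hτ hres
  by_cases hd : RootsDistinct o a₁ a₂ a₃ b
  · exact h V E ends o a₁ a₂ a₃ b F τ hτ hres hd
  · rw [typedCount_eq_zero_of_not_rootsDistinct ends hd]

/-- **The crux of record from (TRI) on the distinct-root residual instances.** -/
theorem HCov_all_of_residual_rootsDistinct (h : ResidualD_all R) : HCov_all R :=
  HCov_all_of_residual_all R (residual_all_of_residualD_all R h)

/-- **The crux of record from the two parts of `NR` with distinct roots.** -/
theorem HCov_all_of_sep_con_rootsDistinct (hs : ResidualSepD_all R) (hc : ResidualConD_all R) :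
    HCov_all R := by
  refine HCov_all_of_residual_rootsDistinct R ?_
  intro V E _ _ _ _ ends o a₁ a₂ a₃ b F τ hτ hres hd
  rcases residual_sep_or_con hres with h | h
  · exact hs V E ends o a₁ a₂ a₃ b F τ hτ h hd
  · exact hc V E ends o a₁ a₂ a₃ b F τ hτ h hd

end Closure

end TypedRed

end CovForm

end Summit.Ventures.PercRepro2
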